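import Summits.QuantumAdvantage.QuantumAdvantage.Theorems.ClusterLawA

set_option linter.dupNamespace false

/-!
# Cluster law, part B (lens 4, g28): the CLUSTER LEMMA — a functional equation over pairwise non-parallel functionals forces constant tables

S-PRIME §12, STEP 3 in full.  Registers `j ∈ J` read the values `A j ⬝ᵥ q` of pairwise NON-PARALLEL non-zero linear functionals on `𝔽_p^r`
(one table per projective pencil member: a cluster of registers reading the same quadratic is pre-summed into one table) through arbitrary
tables `T j : 𝔽_p → 𝔽_2`, and the XOR strategy is perfect on the class: `Σ_{j∈J} T j (A j ⬝ᵥ q) = h` for every `q`.  Then EVERY table is constant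
(`cluster_lemma`).  Proof: induction on `|J|`; to certify `k₀` remove another register `j₁` by differencing along a direction `e ∈ ker (A j₁)` with
`A k₀ ⬝ᵥ e ≠ 0` (`exists_dir`, which is where non-parallelism is used), apply the induction hypothesis to the differenced system, and finish with
part A: a difference that is constant is `0` (`not_fdiff_eq_one`, `p` odd) and then the table is constant (`const_of_fdiff_eq_zero`).
-/

namespace Summit.QuantumAdvantage.QuantumAdvantage.Theorems.ClusterLaw

open Finset

variable {p : ℕ} [Fact p.Prime]

/-- a non-zero functional is onto: every value `x` is read at some point `q` -/
theorem exists_dotProduct_eq {r : ℕ} (a : Fin r → ZMod p) (ha : a ≠ 0) (x : ZMod p) : ∃ q : Fin r → ZMod p, a ⬝ᵥ q = x := by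
  obtain ⟨i₀, hi₀⟩ : ∃ i, a i ≠ 0 := by
    by_contra hcon
    push Not at hcon
    exact ha (funext hcon)
  refine ⟨Pi.single i₀ (x / a i₀), ?_⟩
  rw [dotProduct_single, mul_div_cancel₀ x hi₀]

/-- NON-PARALLEL functionals have non-nested kernels: some direction kills `a` but not `b` -/
theorem exists_dir {r : ℕ} (a b : Fin r → ZMod p) (ha : a ≠ 0) (hab : ∀ c : ZMod p, b ≠ c • a) :
    ∃ e : Fin r → ZMod p, a ⬝ᵥ e = 0 ∧ b ⬝ᵥ e ≠ 0 := by
  obtain ⟨i₀, hi₀⟩ : ∃ i, a i ≠ 0 := by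
    by_contra hcon
    push Not at hcon
    exact ha (funext hcon)
  by_contra hcon
  push Not at hcon
  -- every `e_i := a i₀ • δ_i − a i • δ_{i₀}` lies in `ker a`, hence in `ker b`: `b i * a i₀ = b i₀ * a i`
  have key : ∀ i, b i * a i₀ = b i₀ * a i := by
    intro i
    have h1 : a ⬝ᵥ (Pi.single i (a i₀) - Pi.single i₀ (a i)) = 0 := by
      rw [dotProduct_sub, dotProduct_single, dotProduct_single]; ring
    have h2 := hcon _ h1
    rw [dotProduct_sub, dotProduct_single, dotProduct_single, sub_eq_zero] at h2
    exact h2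
  refine hab (b i₀ / a i₀) (funext fun i => ?_)
  rw [Pi.smul_apply, smul_eq_mul]
  field_simp
  exact key i

/-- differencing the functional equation along `e`: the registers with `A j ⬝ᵥ e = 0` drop out, the others are replaced by their differences -/
theorem fe_difference {r m : ℕ} (A : Fin m → (Fin r → ZMod p)) (J : Finset (Fin m)) (T : Fin m → ZMod p → ZMod 2) (h : ZMod 2)
    (hFE : ∀ q, ∑ j ∈ J, T j (A j ⬝ᵥ q) = h) (e : Fin r → ZMod p) (q : Fin r → ZMod p) :
    ∑ j ∈ J.filter (fun j => A j ⬝ᵥ e ≠ 0), fdiff (A j ⬝ᵥ e) (T j) (A j ⬝ᵥ q) = 0 := by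
  have hsum : ∑ j ∈ J, fdiff (A j ⬝ᵥ e) (T j) (A j ⬝ᵥ q) = 0 := by
    have : ∑ j ∈ J, fdiff (A j ⬝ᵥ e) (T j) (A j ⬝ᵥ q) = ∑ j ∈ J, T j (A j ⬝ᵥ (q + e)) - ∑ j ∈ J, T j (A j ⬝ᵥ q) := by
      rw [← sum_sub_distrib]
      refine sum_congr rfl fun j _ => ?_
      rw [fdiff_apply, dotProduct_add]
    rw [this, hFE, hFE, sub_self]
  rw [sum_filter]
  refine (sum_congr rfl fun j _ => ?_).trans hsum
  by_cases hj : A j ⬝ᵥ e ≠ 0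
  · rw [if_pos hj]
  · rw [if_neg hj]
    push Not at hj
    rw [fdiff_apply, hj, add_zero, sub_self]

/-- **CLUSTER LEMMA.**  Pairwise non-parallel non-zero functionals, arbitrary tables `𝔽_p → 𝔽_2` (`p` odd), and the functional equation
`Σ_{j∈J} T j (A j ⬝ᵥ q) = h` for all `q` force every table `T j`, `j ∈ J`, to be constant. -/
theorem cluster_lemma (hp : p ≠ 2) {r m : ℕ} (A : Fin m → (Fin r → ZMod p)) (hA0 : ∀ j, A j ≠ 0)
    (hA : ∀ j j', j ≠ j' → ∀ c : ZMod p, A j ≠ c • A j') :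
    ∀ (J : Finset (Fin m)) (T : Fin m → ZMod p → ZMod 2) (h : ZMod 2),
      (∀ q, ∑ j ∈ J, T j (A j ⬝ᵥ q) = h) → ∀ j ∈ J, ∀ x, T j x = T j 0 := by
  intro J
  induction J using Finset.strongInduction with
  | H J ih =>
    intro T h hFE k₀ hk₀ x
    by_cases hsingle : ∀ j ∈ J, j = k₀
    · -- `J = {k₀}`: the register reads every value, so its table is constant `= h`
      have hJ : J = {k₀} := eq_singleton_iff_unique_mem.mpr ⟨hk₀, hsingle⟩
      have hval : ∀ y, T k₀ y = h := fun y => by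
        obtain ⟨q, hq⟩ := exists_dotProduct_eq (A k₀) (hA0 k₀) y
        have := hFE q
        rw [hJ, sum_singleton, hq] at this
        exact this
      rw [hval x, hval 0]
    · push Not at hsingle
      obtain ⟨j₁, hj₁, hne⟩ := hsingle
      -- a direction killing `A j₁` but not `A k₀`
      obtain ⟨e, he₁, he₀⟩ := exists_dir (A j₁) (A k₀) (hA0 j₁) (hA k₀ j₁ (Ne.symm hne))
      set J' := J.filter (fun j => A j ⬝ᵥ e ≠ 0) with hJ'
      have hJ'lt : J' ⊂ J := by
        refine ⟨filter_subset _ _, fun hsub => ?_⟩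
        have := hsub hj₁
        rw [hJ', mem_filter] at this
        exact this.2 he₁
      have hk₀' : k₀ ∈ J' := by rw [hJ', mem_filter]; exact ⟨hk₀, he₀⟩
      -- the differenced system satisfies the induction hypothesis with `h = 0`
      have hconst := ih J' hJ'lt (fun j => fdiff (A j ⬝ᵥ e) (T j)) 0 (fe_difference A J T h hFE e) k₀ hk₀'
      -- so `Δ_d (T k₀)` is a constant `κ`, `d = A k₀ ⬝ᵥ e ≠ 0`; `κ = 1` is impossible, `κ = 0` gives a constant table
      have h01 : fdiff (A k₀ ⬝ᵥ e) (T k₀) 0 = 0 ∨ fdiff (A k₀ ⬝ᵥ e) (T k₀) 0 = 1 := by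
        generalize fdiff (A k₀ ⬝ᵥ e) (T k₀) 0 = z
        fin_cases z
        · exact Or.inl rfl
        · exact Or.inr rfl
      rcases h01 with h0 | h1
      · exact const_of_fdiff_eq_zero (A k₀ ⬝ᵥ e) he₀ (T k₀) (fun y => by rw [hconst y, h0]) x
      · exact (not_fdiff_eq_one hp (A k₀ ⬝ᵥ e) (T k₀) (fun y => by rw [hconst y, h1])).elim

/-- READING for the run dichotomy: in particular NO register of a non-degenerate pencil configuration can carry a non-constant table — with two
registers reading `x` and `y` (T2′'s two-singletons case) or three reading `x`, `y`, `x + y` (`cauchy_three`) as the first instances. The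
two-register instance, stated over `𝔽_p²` with the coordinate functionals. -/
theorem cluster_lemma_two (T₁ T₂ : ZMod p → ZMod 2) (h : ZMod 2) (hFE : ∀ x y : ZMod p, T₁ x + T₂ y = h) :
    (∀ x, T₁ x = T₁ 0) ∧ (∀ y, T₂ y = T₂ 0) := by
  refine ⟨fun x => ?_, fun y => ?_⟩
  · have h1 := hFE x 0
    have h2 := hFE 0 0
    have := congrArg (fun w => w - T₂ 0) (h1.trans h2.symm)
    simpa using this
  · have h1 := hFE 0 y
    have h2 := hFE 0 0
    have := congrArg (fun w => w - T₁ 0) (h1.trans h2.symm)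
    simpa [add_sub_cancel_left] using this

end Summit.QuantumAdvantage.QuantumAdvantage.Theorems.ClusterLaw
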